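import Literature.AnabelianGeometry.SemiGraphs.TemperedHbddOfNoCore
import Literature.AnabelianGeometry.SemiGraphs.TreeSystemGeodesicBaseEdges
import HarnessLib

/-!
# [SemiAnbd] Thm 3.7 (iii): every base edge under a fixed geodesic HOSTS the compact subgroup
# (the edges travelled by a compatible `C`-fixed pair carry edge-like subgroups containing `C`)

Mochizuki, *Semi-graphs of anabelioids*, Publ. RIMS **42** (2006), §3, Theorem 3.7 (iii), manuscript p. 41
("if `H` fixes two vertices of `𝒢_{∞,j}`, then these two vertices are joined to one another by a single edge";
author's *Comments* (2020) (6)(b): compatible systems of fixed vertices are compared level by level)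
[cite: MochizukiSemiAnbd2006, Thm 3.7(iii) p.41].

PROOF-ONLY tool file (cell abc-iut, block F, FACT-LIST rows F-2772 `EdgeLikeCentralizerAt` / F-2773
`EdgeLikeCentralizer`; seat abc-iut-f-176 gen 4, desk memo `HOME/staging/f/f-176/g4/FINDING-core-bouquet.md` §2
«LESSON»; no definition, no named fact).  At the canonical tower `verticialLevelData_temperedPiChart` (levels `ℕ`):

* `edgeMap_eq_self_of_mem_path` — a subgroup fixing two vertices of `𝒢_{∞,K}` fixes every edge on the path between
  them (`SemiGraph.nodeMap_eq_self_of_isPath`);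
* **`exists_edgeLike_ge_of_mem_geodesic`** — for a subgroup `C ≤ π₁^temp(𝒢)` and two compatible `C`-fixed vertex
  systems `x`, `x'`, every edge `ε` on the path `[x K, x' K]` of a level `K` extends to a COMPATIBLE system of
  `C`-fixed edges through all levels (downwards by the transition maps; upwards because the image of a higher
  geodesic covers the lower one, abc-iut-f-172's `VerticialLevelData.exists_geodesicEdge_over_of_le`, recursion on
  `ℕ`), so by (I3) of the level data (`VerticialLevelData.edge`: the stabiliser of a compatible edge system lies in an
  edge-like subgroup of the common base edge) the base edge `proj ε` of `𝔾` carries an EDGE-LIKE subgroup `L ⊇ C`: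
  the pair `x`, `x'` only ever travels over base edges that can HOST `C`;
* `exists_edgeLike_ge_of_branch_mem_geodesic` — the same for the edge of a branch-point of the path.

This is the reduction behind `TemperedHbddOfNoHostableCore.lean` (the NO-CORE theorem of `TemperedHbddOfNoCore.lean`
relative to the sub-semi-graph of `C`-hostable edges).  Nothing here bears on [IUTchIII] Cor. 3.12; typed ≠ proved.
-/

namespace Literature.AnabelianGeometry.SemiGraphs

namespace ProfiniteSemiGraph

open CategoryTheory Topology

universe u
variable (𝒢 : ProfiniteSemiGraph.{u})

/-- **A subgroup fixing the two ends of a path of `𝒢_{∞,K}` fixes every edge on it** (paths of the subdivision of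
a tree with fixed endpoints are fixed node by node). [cite: MochizukiSemiAnbd2006, Thm 3.7(iii) p.41] -/
theorem edgeMap_eq_self_of_mem_path (h36 : 𝒢.Prop36Hypotheses)
    (C : Subgroup (𝒢.temperedPiChart h36).G)
    (x x' : ∀ j, ((verticialLevelData_temperedPiChart (h36 := h36)).tree j).Vertex)
    (hfx : ∀ g ∈ C, ∀ j, ((verticialLevelData_temperedPiChart (h36 := h36)).act j g).hom.vertexMap (x j) = x j)
    (hfx' : ∀ g ∈ C, ∀ j, ((verticialLevelData_temperedPiChart (h36 := h36)).act j g).hom.vertexMap (x' j) = x' j)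
    (K : ℕ) (p : ((verticialLevelData_temperedPiChart (h36 := h36)).tree K).subdivision.Walk
      (Sum.inl (x K)) (Sum.inl (x' K))) (hp : p.IsPath)
    (ε : ((verticialLevelData_temperedPiChart (h36 := h36)).tree K).Edge)
    (hε : (Sum.inr (Sum.inl ε) : ((verticialLevelData_temperedPiChart (h36 := h36)).tree K).Node) ∈ p.support) :
    ∀ g ∈ C, ((verticialLevelData_temperedPiChart (h36 := h36)).act K g).hom.edgeMap ε = ε := by
  intro g hg
  have hxn : SemiGraph.nodeMap ((verticialLevelData_temperedPiChart (h36 := h36)).act K g) (Sum.inl (x K)) =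
      Sum.inl (x K) := by simp [hfx g hg K]
  have hx'n : SemiGraph.nodeMap ((verticialLevelData_temperedPiChart (h36 := h36)).act K g) (Sum.inl (x' K)) =
      Sum.inl (x' K) := by simp [hfx' g hg K]
  have h := SemiGraph.nodeMap_eq_self_of_isPath
    ((verticialLevelData_temperedPiChart (h36 := h36)).isTree K).isTree.isAcyclic _ hxn hx'n p hp _ hε
  simpa only [SemiGraph.nodeMap_inr_inl, Sum.inr.injEq, Sum.inl.injEq] using h

/-- **Every base edge under a fixed geodesic hosts `C`.**  At the canonical tower, for a subgroup `C ≤ π₁^temp(𝒢)`,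
two compatible `C`-fixed vertex systems `x`, `x'` and an edge `ε` on the path `[x K, x' K]` of some level `K`: there
is an EDGE-LIKE subgroup over the base edge of `ε` containing `C`.  The compatible `C`-fixed edge system through `ε`
is `trans ε` below `K` and, above `K`, is chosen recursively on the geodesics (abc-iut-f-172's
`exists_geodesicEdge_over_of_le`); its stabiliser lies in an edge-like subgroup by (I3) `VerticialLevelData.edge`.
[cite: MochizukiSemiAnbd2006, Thm 3.7(iii) p.41] -/
theorem exists_edgeLike_ge_of_mem_geodesic (h36 : 𝒢.Prop36Hypotheses)
    (C : Subgroup (𝒢.temperedPiChart h36).G)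
    (x x' : ∀ j, ((verticialLevelData_temperedPiChart (h36 := h36)).tree j).Vertex)
    (hx : ∀ ⦃i j : ℕ⦄ (hij : i ≤ j),
      ((verticialLevelData_temperedPiChart (h36 := h36)).trans hij).vertexMap (x j) = x i)
    (hx' : ∀ ⦃i j : ℕ⦄ (hij : i ≤ j),
      ((verticialLevelData_temperedPiChart (h36 := h36)).trans hij).vertexMap (x' j) = x' i)
    (hfx : ∀ g ∈ C, ∀ j, ((verticialLevelData_temperedPiChart (h36 := h36)).act j g).hom.vertexMap (x j) = x j)
    (hfx' : ∀ g ∈ C, ∀ j, ((verticialLevelData_temperedPiChart (h36 := h36)).act j g).hom.vertexMap (x' j) = x' j)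
    (K : ℕ) (p : ((verticialLevelData_temperedPiChart (h36 := h36)).tree K).subdivision.Walk
      (Sum.inl (x K)) (Sum.inl (x' K))) (hp : p.IsPath)
    (ε : ((verticialLevelData_temperedPiChart (h36 := h36)).tree K).Edge)
    (hε : (Sum.inr (Sum.inl ε) : ((verticialLevelData_temperedPiChart (h36 := h36)).tree K).Node) ∈ p.support) :
    ∃ L ∈ edgeLikeSubgroups (𝒢.temperedPiChart h36)
      (((verticialLevelData_temperedPiChart (h36 := h36)).proj K).edgeMap ε), C ≤ L := by
  classical
  let D := verticialLevelData_temperedPiChart (h36 := h36) (𝒢 := 𝒢)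
  -- a path (the geodesic) at every level
  have hq : ∀ j : ℕ, ∃ q : (D.tree j).subdivision.Walk (Sum.inl (x j)) (Sum.inl (x' j)), q.IsPath := fun j => by
    obtain ⟨q, hq⟩ := (D.isTree j).isTree.connected.exists_walk_length_eq_dist (Sum.inl (x j)) (Sum.inl (x' j))
    exact ⟨q, q.isPath_of_length_eq_dist hq⟩
  choose q hq using hq
  -- `ε` lies on the geodesic of level `K` (nodes of a path lie on every walk)
  have hεq : (Sum.inr (Sum.inl ε) : (D.tree K).Node) ∈ (q K).support :=
    SemiGraph.mem_support_of_mem_support_path (D.isTree K).isTree.isAcyclic p hp hε (q K)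
  -- the compatible edge system: `trans ε` below `K`, geodesic lifts above `K`
  let sys : ∀ j : ℕ, {e : (D.tree j).Edge // K ≤ j → (Sum.inr (Sum.inl e) : (D.tree j).Node) ∈ (q j).support} :=
    fun j => Nat.rec (motive := fun j =>
        {e : (D.tree j).Edge // K ≤ j → (Sum.inr (Sum.inl e) : (D.tree j).Node) ∈ (q j).support})
      ⟨(D.trans (Nat.zero_le K)).edgeMap ε, fun h => by
        obtain rfl : K = 0 := Nat.le_zero.1 h
        rwa [D.trans_edgeMap_refl]⟩
      (fun j ih =>
        if h : j + 1 ≤ K then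
          ⟨(D.trans h).edgeMap ε, fun h' => by
            obtain rfl : K = j + 1 := le_antisymm h' h
            rwa [D.trans_edgeMap_refl]⟩
        else
          ⟨Classical.choose (D.exists_geodesicEdge_over_of_le x x' hx hx' (Nat.le_succ j) (q j) (hq j)
              (q (j + 1)) (ih.2 (by omega))),
            fun _ => (Classical.choose_spec (D.exists_geodesicEdge_over_of_le x x' hx hx' (Nat.le_succ j)
              (q j) (hq j) (q (j + 1)) (ih.2 (by omega)))).1⟩) j
  -- below `K` the system is `trans ε`
  have hlow : ∀ j (h : j ≤ K), (sys j).1 = (D.trans h).edgeMap ε := by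
    intro j h
    cases j with
    | zero => rfl
    | succ j =>
      show (dite (j + 1 ≤ K) _ _ : {e : (D.tree (j + 1)).Edge // _}).1 = _
      rw [dif_pos h]
  -- one-step compatibility
  have hstep : ∀ j, (D.trans (Nat.le_succ j)).edgeMap (sys (j + 1)).1 = (sys j).1 := by
    intro j
    by_cases h : j + 1 ≤ K
    · rw [hlow (j + 1) h, hlow j (by omega), D.trans_edgeMap_comp]
    · show (D.trans (Nat.le_succ j)).edgeMap (dite (j + 1 ≤ K) _ _ : {e : (D.tree (j + 1)).Edge // _}).1 = _
      rw [dif_neg h]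
      exact (Classical.choose_spec (D.exists_geodesicEdge_over_of_le x x' hx hx' (Nat.le_succ j) (q j) (hq j)
        (q (j + 1)) ((sys j).2 (by omega)))).2.1
  -- compatibility
  have hcompat : ∀ ⦃i j : ℕ⦄ (h : i ≤ j), (D.trans h).edgeMap (sys j).1 = (sys i).1 := by
    intro i j h
    induction j, h using Nat.le_induction with
    | base => exact D.trans_edgeMap_refl i _
    | succ j hij ih =>
      rw [← D.trans_edgeMap_comp hij (Nat.le_succ j), hstep j, ih]
  -- every edge of the system is `C`-fixed
  have hfix : ∀ g ∈ C, ∀ j : ℕ, (D.act j g).hom.edgeMap (sys j).1 = (sys j).1 := by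
    intro g hg j
    by_cases h : j ≤ K
    · rw [hlow j h, ← D.trans_act_edgeMap h g ε, 𝒢.edgeMap_eq_self_of_mem_path h36 C x x' hfx hfx' K p hp ε hε g hg]
    · exact 𝒢.edgeMap_eq_self_of_mem_path h36 C x x' hfx hfx' j (q j) (hq j) _ ((sys j).2 (by omega)) g hg
  -- (I3): the stabiliser of the system lies in an edge-like subgroup of the common base edge
  obtain ⟨e, L, hL, hproj, hstab⟩ := D.edge (0 : ℕ) (fun j => (sys j.1).1) (fun i j h => hcompat h)
  have he : e = (D.proj K).edgeMap ε := by
    rw [← hproj ⟨K, Nat.zero_le K⟩]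
    show (D.proj K).edgeMap (sys K).1 = _
    rw [hlow K le_rfl, D.trans_edgeMap_refl]
  refine ⟨L, he ▸ hL, fun g hg => hstab g fun j => ⟨hfix g hg j.1, fun b hb => ?_⟩⟩
  exact D.branchMap_eq_of_edgeMap_eq j.1 g b (by rw [hb]; exact hfix g hg j.1)

/-- **Branch form**: the base edge of a branch-point of the path `[x K, x' K]` hosts `C` (the edge-point of that
branch is on the path too: on a path between vertex-points a branch-point is flanked by its vertex-point and its
edge-point). [cite: MochizukiSemiAnbd2006, Thm 3.7(iii) p.41] -/
theorem exists_edgeLike_ge_of_branch_mem_geodesic (h36 : 𝒢.Prop36Hypotheses)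
    (C : Subgroup (𝒢.temperedPiChart h36).G)
    (x x' : ∀ j, ((verticialLevelData_temperedPiChart (h36 := h36)).tree j).Vertex)
    (hx : ∀ ⦃i j : ℕ⦄ (hij : i ≤ j),
      ((verticialLevelData_temperedPiChart (h36 := h36)).trans hij).vertexMap (x j) = x i)
    (hx' : ∀ ⦃i j : ℕ⦄ (hij : i ≤ j),
      ((verticialLevelData_temperedPiChart (h36 := h36)).trans hij).vertexMap (x' j) = x' i)
    (hfx : ∀ g ∈ C, ∀ j, ((verticialLevelData_temperedPiChart (h36 := h36)).act j g).hom.vertexMap (x j) = x j)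
    (hfx' : ∀ g ∈ C, ∀ j, ((verticialLevelData_temperedPiChart (h36 := h36)).act j g).hom.vertexMap (x' j) = x' j)
    (K : ℕ) (p : ((verticialLevelData_temperedPiChart (h36 := h36)).tree K).subdivision.Walk
      (Sum.inl (x K)) (Sum.inl (x' K))) (hp : p.IsPath)
    (β : ((verticialLevelData_temperedPiChart (h36 := h36)).tree K).Branch)
    (hβ : (Sum.inr (Sum.inr β) : ((verticialLevelData_temperedPiChart (h36 := h36)).tree K).Node) ∈ p.support) :
    ∃ L ∈ edgeLikeSubgroups (𝒢.temperedPiChart h36)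
      (((verticialLevelData_temperedPiChart (h36 := h36)).proj K).edgeMap
        (((verticialLevelData_temperedPiChart (h36 := h36)).tree K).edgeOf β)), C ≤ L := by
  classical
  let D := verticialLevelData_temperedPiChart (h36 := h36) (𝒢 := 𝒢)
  refine 𝒢.exists_edgeLike_ge_of_mem_geodesic h36 C x x' hx hx' hfx hfx' K p hp _ ?_
  -- the edge-point of `β` is a neighbour of the branch-point `β` on the path
  obtain ⟨i, hi, hiβ⟩ : ∃ i, i ≤ p.length ∧ p.getVert i = Sum.inr (Sum.inr β) := by
    obtain ⟨i, hi, h⟩ := SimpleGraph.Walk.mem_support_iff_exists_getVert.1 hβ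
    exact ⟨i, h, hi⟩
  have hi0 : i ≠ 0 := by
    rintro rfl
    rw [SimpleGraph.Walk.getVert_zero] at hiβ
    simp at hiβ
  have hil : i ≠ p.length := by
    rintro rfl
    rw [SimpleGraph.Walk.getVert_length] at hiβ
    simp at hiβ
  obtain ⟨i₁, rfl⟩ := Nat.exists_eq_succ_of_ne_zero hi0
  -- the two neighbours of the branch-point on the path
  have hprev : (D.tree K).subdivision.Adj (Sum.inr (Sum.inr β)) (p.getVert i₁) := by
    rw [← hiβ]; exact (p.adj_getVert_succ (by omega)).symm
  have hnext : (D.tree K).subdivision.Adj (Sum.inr (Sum.inr β)) (p.getVert (i₁ + 2)) := by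
    rw [← hiβ]; exact p.adj_getVert_succ (by omega)
  rcases ((D.tree K).subdivision_adj_branch_iff β _).1 hprev with h1 | ⟨v₁, hv₁, h1⟩
  · rw [← h1]; exact p.getVert_mem_support i₁
  rcases ((D.tree K).subdivision_adj_branch_iff β _).1 hnext with h2 | ⟨v₂, hv₂, h2⟩
  · rw [← h2]; exact p.getVert_mem_support (i₁ + 2)
  -- both neighbours are the vertex-point of `β`: contradicts injectivity of the path
  exfalso
  rw [hv₁] at hv₂
  obtain rfl : v₁ = v₂ := by simpa using hv₂
  have heq : p.getVert i₁ = p.getVert (i₁ + 2) := by rw [h1, h2]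
  have := hp.getVert_injOn (by rw [Set.mem_setOf_eq]; omega) (by rw [Set.mem_setOf_eq]; omega) heq
  omega

end ProfiniteSemiGraph

end Literature.AnabelianGeometry.SemiGraphs
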